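import Literature.LinearAlgebra.Matrix.UnitaryThreeMinimalNilpotentWitt     -- ★ p852074 (E): `unitary_conj_mem`, `inv_eq_of_unitary`, `isUnit_det_of_unitary`
import Mathlib.Topology.Instances.Matrix
import Mathlib.Topology.Algebra.ContinuousMonoidHom
import HarnessLib

/-!
# `Ad g` on the trace-zero unitary Lie algebra of `J₃` as a CONTINUOUS ADDITIVE AUTOMORPHISM, preserving the discriminant of the characteristic polynomial
# (the transport step of Witt's theorem for the minimal nilpotent orbit)

Topic `LinearAlgebra/Matrix`; namespace `Literature.LinearAlgebra.Matrix.UnitaryThreeWitt` (continued).  THEOREMS ONLY (no definition ∕ instance ∕ notation ∕ named fact ∕ `sorry`).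
Brick (W-T) «WITT TRANSPORT» of the `hodgecm-mathlib` cell's ROAD «HC-D» (crux H413 = `stmt-HodgeConjecture-24833`; count-neutral), for D5(iii) (A-p12 (g29)): with ★ (E)
`exists_unitary_conj_single_zero_two` every minimal nilpotent `N′ ∈ 𝔲` is `g (c·E₀₂) g⁻¹` for a unitary `g`; this file packages `X ↦ g X g⁻¹` as `e : ↥𝔲₀ ≃ₜ+ ↥𝔲₀` (R3 carriers:
an ARBITRARY `𝔲₀ : AddSubgroup (Matrix (Fin 3) (Fin 3) K)` with membership hypothesis `h𝔲₀`, `K` a topological field) together with `discr (χ_{gXg⁻¹}) = discr (χ_X)`, so that an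
`R2`-shape bound «`∃ U ∈ 𝓝 X₀, ∫⁻ X in U, ηι ↑X ∂μ < ∞`» moves from the model to `N′` by the cell's Haar-transport lemma (★ (HT), LH10-p01) — not repeated here.

* `unitary_inv` (`g` unitary ⇒ `g⁻¹` unitary), `trace_unitary_conj` (`tr (g X g⁻¹) = tr X`), `unitary_conj_mem_traceZero` (`Ad g` preserves `𝔲₀`),
  **`exists_adContinuousAddEquiv`** (`∃ e : ↥𝔲₀ ≃ₜ+ ↥𝔲₀`, `↑(e X) = g X g⁻¹`, `↑(e.symm X) = g⁻¹ X g`), `discr_unitary_conj` (`Matrix.discr (g X g⁻¹) = Matrix.discr X`),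
  `charpoly_discr_unitary_conj` (the same in the `(Matrix.charpoly _).discr` spelling of the road's integrand `ηι`).

## References
* [Rogawski1990] J. D. Rogawski, *Automorphic Representations of Unitary Groups in Three Variables* (1990), §1.9 p. 8 (the unitary group acting on its Lie algebra). Context locator.
* [HornJohnson2013] R. A. Horn, C. R. Johnson, *Matrix Analysis*, 2nd ed. (2013), §1.3 (similarity invariance of the characteristic polynomial). Context locator.
-/

set_option autoImplicit false

open Matrix

namespace Literature.LinearAlgebra.Matrix.UnitaryThreeWitt

section Algebra

variable {K : Type*} [Field K] (σ : K →+* K)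

/-- The inverse of a unitary matrix is unitary. [cite: Rogawski1990, §1.9 p. 8] -/
theorem unitary_inv {g : Matrix (Fin 3) (Fin 3) K}
    (hg : (g.map σ)ᵀ * !![(0 : K), 0, 1; 0, 1, 0; 1, 0, 0] * g = !![(0 : K), 0, 1; 0, 1, 0; 1, 0, 0]) :
    (g⁻¹.map σ)ᵀ * !![(0 : K), 0, 1; 0, 1, 0; 1, 0, 0] * g⁻¹ = !![(0 : K), 0, 1; 0, 1, 0; 1, 0, 0] := by
  have hdet := isUnit_det_of_unitary σ hg
  have hdetσ : IsUnit ((g.map σ)ᵀ).det := by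
    rw [Matrix.det_transpose, show (g.map σ).det = σ g.det by rw [← RingHom.mapMatrix_apply, ← RingHom.map_det]]
    exact hdet.map σ
  have hmapinv : g⁻¹.map σ = (g.map σ)⁻¹ := by
    refine (Matrix.inv_eq_left_inv ?_).symm
    rw [← Matrix.map_mul, Matrix.nonsing_inv_mul g hdet, Matrix.map_one σ (map_zero σ) (map_one σ)]
  rw [hmapinv, Matrix.transpose_nonsing_inv]
  nth_rw 1 [← hg]
  rw [Matrix.mul_assoc, Matrix.mul_assoc, Matrix.mul_assoc, Matrix.mul_nonsing_inv g hdet, Matrix.mul_one, ← Matrix.mul_assoc,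
    Matrix.nonsing_inv_mul _ hdetσ, Matrix.one_mul]

/-- `tr (g X g⁻¹) = tr X` for unitary `g`. [cite: HornJohnson2013, §1.3] -/
theorem trace_unitary_conj {g : Matrix (Fin 3) (Fin 3) K}
    (hg : (g.map σ)ᵀ * !![(0 : K), 0, 1; 0, 1, 0; 1, 0, 0] * g = !![(0 : K), 0, 1; 0, 1, 0; 1, 0, 0]) (X : Matrix (Fin 3) (Fin 3) K) :
    Matrix.trace (g * X * g⁻¹) = Matrix.trace X := by
  rw [Matrix.trace_mul_cycle, Matrix.nonsing_inv_mul g (isUnit_det_of_unitary σ hg), Matrix.one_mul]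

/-- `Ad g` preserves the trace-zero unitary Lie algebra `𝔲₀` (given by its membership hypothesis). [cite: Rogawski1990, §1.9 p. 8] -/
theorem unitary_conj_mem_traceZero (hσ : ∀ x, σ (σ x) = x) {g : Matrix (Fin 3) (Fin 3) K}
    (hg : (g.map σ)ᵀ * !![(0 : K), 0, 1; 0, 1, 0; 1, 0, 0] * g = !![(0 : K), 0, 1; 0, 1, 0; 1, 0, 0])
    (𝔲₀ : AddSubgroup (Matrix (Fin 3) (Fin 3) K))
    (h𝔲₀ : ∀ X, X ∈ 𝔲₀ ↔ (X.map σ)ᵀ * !![(0 : K), 0, 1; 0, 1, 0; 1, 0, 0] + !![(0 : K), 0, 1; 0, 1, 0; 1, 0, 0] * X = 0 ∧ Matrix.trace X = 0)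
    {X : Matrix (Fin 3) (Fin 3) K} (hX : X ∈ 𝔲₀) : g * X * g⁻¹ ∈ 𝔲₀ := by
  obtain ⟨hXs, hXt⟩ := (h𝔲₀ X).mp hX
  exact (h𝔲₀ _).mpr ⟨unitary_conj_mem σ hσ hg hXs, by rw [trace_unitary_conj σ hg, hXt]⟩

/-- `Matrix.discr (g X g⁻¹) = Matrix.discr X` for unitary `g` (★ `discr_units_conj`). [cite: HornJohnson2013, §1.3] -/
theorem discr_unitary_conj {g : Matrix (Fin 3) (Fin 3) K}
    (hg : (g.map σ)ᵀ * !![(0 : K), 0, 1; 0, 1, 0; 1, 0, 0] * g = !![(0 : K), 0, 1; 0, 1, 0; 1, 0, 0]) (X : Matrix (Fin 3) (Fin 3) K) :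
    Matrix.discr (g * X * g⁻¹) = Matrix.discr X := by
  exact discr_units_conj g X (isUnit_det_of_unitary σ hg)

/-- The same in the road's integrand spelling: `(χ_{g X g⁻¹}).discr = (χ_X).discr`. [cite: HornJohnson2013, §1.3] -/
theorem charpoly_discr_unitary_conj {g : Matrix (Fin 3) (Fin 3) K}
    (hg : (g.map σ)ᵀ * !![(0 : K), 0, 1; 0, 1, 0; 1, 0, 0] * g = !![(0 : K), 0, 1; 0, 1, 0; 1, 0, 0]) (X : Matrix (Fin 3) (Fin 3) K) :
    (Matrix.charpoly (g * X * g⁻¹)).discr = (Matrix.charpoly X).discr := by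
  exact discr_unitary_conj σ hg X

end Algebra

section Topology

variable {K : Type*} [Field K] [TopologicalSpace K] [IsTopologicalRing K] (σ : K →+* K)

/-- **`Ad g : ↥𝔲₀ ≃ₜ+ ↥𝔲₀`** for unitary `g` (continuous additive automorphism with continuous inverse `Ad g⁻¹`), as an ∃-bundle (no definition).
[cite: Rogawski1990, §1.9 p. 8] -/
theorem exists_adContinuousAddEquiv (hσ : ∀ x, σ (σ x) = x) {g : Matrix (Fin 3) (Fin 3) K}
    (hg : (g.map σ)ᵀ * !![(0 : K), 0, 1; 0, 1, 0; 1, 0, 0] * g = !![(0 : K), 0, 1; 0, 1, 0; 1, 0, 0])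
    (𝔲₀ : AddSubgroup (Matrix (Fin 3) (Fin 3) K))
    (h𝔲₀ : ∀ X, X ∈ 𝔲₀ ↔ (X.map σ)ᵀ * !![(0 : K), 0, 1; 0, 1, 0; 1, 0, 0] + !![(0 : K), 0, 1; 0, 1, 0; 1, 0, 0] * X = 0 ∧ Matrix.trace X = 0) :
    ∃ e : ↥𝔲₀ ≃ₜ+ ↥𝔲₀, (∀ X : ↥𝔲₀, ((e X : ↥𝔲₀) : Matrix (Fin 3) (Fin 3) K) = g * (X : Matrix (Fin 3) (Fin 3) K) * g⁻¹) ∧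
      ∀ X : ↥𝔲₀, ((e.symm X : ↥𝔲₀) : Matrix (Fin 3) (Fin 3) K) = g⁻¹ * (X : Matrix (Fin 3) (Fin 3) K) * g := by
  have hdet := isUnit_det_of_unitary σ hg
  have hg' := unitary_inv σ hg
  have hmem : ∀ X : ↥𝔲₀, g * (X : Matrix (Fin 3) (Fin 3) K) * g⁻¹ ∈ 𝔲₀ := fun X => unitary_conj_mem_traceZero σ hσ hg 𝔲₀ h𝔲₀ X.2
  have hmem' : ∀ X : ↥𝔲₀, g⁻¹ * (X : Matrix (Fin 3) (Fin 3) K) * g ∈ 𝔲₀ := fun X => by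
    have h := unitary_conj_mem_traceZero σ hσ hg' 𝔲₀ h𝔲₀ X.2
    rwa [Matrix.nonsing_inv_nonsing_inv g hdet] at h
  refine ⟨{ toFun := fun X => ⟨g * (X : Matrix (Fin 3) (Fin 3) K) * g⁻¹, hmem X⟩,
             invFun := fun X => ⟨g⁻¹ * (X : Matrix (Fin 3) (Fin 3) K) * g, hmem' X⟩,
             left_inv := fun X => Subtype.ext (by
               change g⁻¹ * (g * (X : Matrix (Fin 3) (Fin 3) K) * g⁻¹) * g = (X : Matrix (Fin 3) (Fin 3) K)
               rw [Matrix.mul_assoc g, Matrix.nonsing_inv_mul_cancel_left g _ hdet, Matrix.nonsing_inv_mul_cancel_right g _ hdet]),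
             right_inv := fun X => Subtype.ext (by
               change g * (g⁻¹ * (X : Matrix (Fin 3) (Fin 3) K) * g) * g⁻¹ = (X : Matrix (Fin 3) (Fin 3) K)
               rw [Matrix.mul_assoc g⁻¹, Matrix.mul_nonsing_inv_cancel_left g _ hdet, Matrix.mul_nonsing_inv_cancel_right g _ hdet]),
             map_add' := fun X Y => Subtype.ext (by
               change g * ((X : Matrix (Fin 3) (Fin 3) K) + (Y : Matrix (Fin 3) (Fin 3) K)) * g⁻¹ =
                 g * (X : Matrix (Fin 3) (Fin 3) K) * g⁻¹ + g * (Y : Matrix (Fin 3) (Fin 3) K) * g⁻¹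
               rw [Matrix.mul_add, Matrix.add_mul]),
             continuous_toFun := ((continuous_const.matrix_mul continuous_subtype_val).matrix_mul continuous_const).subtype_mk _,
             continuous_invFun := ((continuous_const.matrix_mul continuous_subtype_val).matrix_mul continuous_const).subtype_mk _ },
    fun X => rfl, fun X => rfl⟩

end Topology

end Literature.LinearAlgebra.Matrix.UnitaryThreeWitt
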